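import Summits.AtomisticToContinuum.BoseEinsteinCondensation.Theorems.BECThomsonPrincipleGDTransferSeededCountLaw
import Summits.AtomisticToContinuum.BoseEinsteinCondensation.Theorems.BECThomsonPrincipleGDTransferSeededFreeCorner
import Summits.AtomisticToContinuum.BoseEinsteinCondensation.Theorems.BECThomsonPrincipleGDTransferSeededIvtGlue
import Summits.AtomisticToContinuum.BoseEinsteinCondensation.Theorems.BECThomsonPrincipleGDTransferSeededLocalConstancy

/-!
# Route `BECThomsonPrinciple`, crux `GDTransfer` (stmt-AtomisticToContinuum-9482), line `seeded-continuity`: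
# the reduction of the crux to its three open stubs, and the conditional soft transfer

Supports (does not close) stmt-AtomisticToContinuum-9482.  With the four tree-technology stubs of the line landed
(`stub_countLaw` p138222, `stub_freeCorner` p138122, `stub_localConstancy` p138765, `stub_ivtGlue` p138348) the
sorry-free composition `GDTransfer_of` of the Defs module reduces the crux to exactly three statements
(`GDTransfer_of_open_stubs`, registered): the SEED `NoBalancedCat` (near-minimisers along the dilute path are never
balanced macroscopic superpositions of a depleted and a condensed branch — the prepared sub-crux), the DICHOTOMY
`GaussianDominationCan → BandEmptiness` for finite continuous profiles (the only consumer of Gaussian domination), and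
the ROUGH-POTENTIAL regime (hard cores, discontinuous profiles; implied by the crux).  Independently of Gaussian
domination, `periodicBECFor_of_seed_of_bandEmptiness` is the PROVED conditional transfer "no balanced cat + empty middle
band of the `n̂₀`-law at near-minimisers ⇒ condensation of the near-minimisers at every small density" for every
admissible finite continuous pair potential — the continuity-in-the-side mechanism of the line, unconditional.

References: KennedyLiebShastry1988 (IR bound ⇒ order); LSSY2005 §1.2, Thm 2.2, Ch. 5; ReedSimonIV1978 §XIII.12.
-/

noncomputable section

namespace Summit.AtomisticToContinuum.BoseEinsteinCondensation.Cruxes.GDTransfer.Seeded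

open Literature.MathematicalPhysics.QuantumManyBody.BoseGas
open Summit.AtomisticToContinuum.BoseEinsteinCondensation.Theses.BECThomsonPrinciple
open Summit.AtomisticToContinuum.BoseEinsteinCondensation.Cruxes.GDTransfer.DysonDressedWitness (PeriodicBECFor)
open scoped ENNReal

/-- **Conditional soft transfer (proved).**  If near-minimisers are never balanced cats (`NoBalancedCat`) and the
middle band `θN ≤ n̂₀ < (1−β)N` of their `n̂₀`-law is empty uniformly down the density scale (`BandEmptiness v`), then
the `δ`-near-minimisers of the periodic energy condense at every small density (`PeriodicBECFor v`), for every
admissible finite continuous pair potential `v`: count law + free corner + local constancy in the side + connectedness. -/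
theorem periodicBECFor_of_seed_of_bandEmptiness (hSeed : NoBalancedCat) {v : ℝ → ℝ≥0∞}
    (hv : IsRepulsiveFiniteRange v) (hfc : IsFiniteContinuous v) (hBand : BandEmptiness v) : PeriodicBECFor v :=
  stub_ivtGlue stub_countLaw hSeed v hv hBand (stub_freeCorner v hv) (stub_localConstancy stub_countLaw v hv hfc)

/-- **The crux from its three open stubs** (registered): the seed, the dichotomy (GD ⇒ band emptiness for finite
continuous profiles) and the rough-potential regime give `GDTransfer`, the other four stubs of the line being theorems. -/
theorem GDTransfer_of_open_stubs :
    Sig.stub_noBalancedCat → Sig.stub_projectedDichotomy → Sig.stub_roughPotentials → GDTransfer :=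
  fun hSeed hDich hRough =>
    GDTransfer_of hSeed hDich stub_freeCorner stub_countLaw stub_localConstancy stub_ivtGlue hRough

end Summit.AtomisticToContinuum.BoseEinsteinCondensation.Cruxes.GDTransfer.Seeded

end
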